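import Summits.CriticalPhenomena.PercolationContinuityZ3.Theses.PercNearOneGluing
import Summits.CriticalPhenomena.PercolationContinuityZ3.Theorems.PercNearOneGluingAdditiveGluingGoodStepResidual
import Summits.CriticalPhenomena.PercolationContinuityZ3.Theorems.PercNearOneGluingAdditiveGluingGoodStep
import Summits.CriticalPhenomena.PercolationContinuityZ3.Theorems.PercNearOneGluingAdditiveGluingGoodBase
import Summits.CriticalPhenomena.PercolationContinuityZ3.Theorems.PercNearOneGluingAdditiveGluingLemma5AnyRelay
import HarnessLib

/-!
# TEMPLATE (NOT a registered line — STUB B below is FALSE, CONTROL-CENSUS C20/C25): the pair step SPLIT into a pure-BHK hijack bound + a residual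
# Kept because the composition is kernel-checked: any TRUE residual of the shape `pair step with margin = provable slack` plugs into STUB B's slot.
(crux item stmt-CriticalPhenomena-4576; control-strategist seat, generation 3, 2026-08-17; built on line `peel` (g2) whose composition is
reused verbatim — see `Lines/peel.lean`, `Lines/bhk-split.md`, CONTROL-CENSUS.md §Generation 3)

Crux (FIXED, by name): `AdditiveGluing`.  Notation as in `peel`: one weighting `u`, relays `A ∋ b`, minimiser `a₀ ∈ argmin_A μ_u(· ↔ b)`,
point `s`, added vertex `x`, `S = {s, x}`; `Z(s) = Σ_{W∋s, W∩A=∅} μ(C(s)=W)·min_A μ(a↔b in Wᶜ)`, `Z(S)` the same for the block cluster,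
`K(s) = μ(s↔b) + Z(s) − μ(a₀↔b)`, `K(S) = μ(S↔b) + Z(S) − μ(a₀↔b) − μ(a₀↮b, a₀↔S, S↔b)`.
NORMAL FORM of the pair step (this seat): `K(S)Z(s) − K(s)Z(S) = K(s)·(Z(s)−Z(S)) + Z(s)·(E₁ + IHV − Hij)` with `Hij = μ(s↔b, a₀↮s, x↔a₀)`
(the hijack), and the one-relay proof is `Z(s)·Hij ≤ WIN(s)·(Z(s)−Z(S))`.  With ≥ 2 relays the whole hijack cannot be bounded by BHK (the
bound is 17× lossy when `x` is swallowed by the winner's cluster), but its `x ∉ C(s)` part can, POCKET-WISE: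
* STUB A `stub_hijackSplitBHK` (M, pure BHK 1.3 given `s ↮ {a₀, x}`, NO designation hypothesis): `Z_{x∉}(s)·Hij ≤ WIN_{x∉}(s)·Zx(s)`,
  `Zx(s) = Σ_{W∌x} μ(C(s)=W)·min_A μ(a↔b in Wᶜ)·μ(x↔a₀ in Wᶜ)`.
* STUB B `stub_pairResidual` (XL, the residual `S2q ≥ 0`): `D(s)(Z(s)−Z(S)) + Z_{x∈}(s)·Hij + WIN_{x∉}(s)·Zx(s) ≤ Z(s)·μ(s↮b, a₀↮s, x↔b)`
  given `hmin`, badness of `s, x` and point goodness `0 ≤ K(s)` — **FALSE** (5-vertex witness in CONTROL-CENSUS C20; 170/3 723 exhaustive n = 6 at p = ½); kept only as the slot of the template.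
* STUB C `stub_gainIdentity` (S, bookkeeping): `μ(S↔b) − μ(s↔b) − μ(a₀↮b, a₀↔S, S↔b) = μ(s↮b, a₀↮s, x↔b) − Hij`.
* `ratioMonotonePair_of_split` (REAL): A + B + C ⟹ g0's `stub_ratioMonotonePair` (with `0 ≤ K(s)` handed in, which `blockGood_of_peel` holds).
* STUBS `stub_peel`, `stub_goodStaysGoodBlock`: verbatim from line `peel` (the deep seat's gluing transfer p166214 reduces `stub_peel` to the pair
  form in `u/T`; STUB B was tested in that setting too, 0 violations).
Real proofs `blockGood_of_peel` … `AdditiveGluing_of` are line `peel`'s (g0/g2), with the single change that the pair hypothesis carries `0 ≤ K(s)`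
(supplied from `hKpt`); `additiveGluing_closed` proves the crux BY NAME from the five stubs.
-/

namespace Summit.CriticalPhenomena.PercolationContinuityZ3.Cruxes.AdditiveGluing.BhkSplit

open MeasureTheory Set
open Literature.Probability.LatticeModels (prodBernoulli)
open Literature.Probability.Percolation (BondConfig openConn openConnIn openGraph openCluster)
open Summit.CriticalPhenomena.PercolationContinuityZ3.Theorems
open scoped BigOperators Classical

noncomputable section

/-! ## STUBS -/

/-- **STUB A (NEW, M-sized, pure BHK — no designation hypothesis): the split hijack bound `N2q`.**
`Z_{x∉}(s) · Hij ≤ WIN_{x∉}(s) · Zx(s)`: the dead-pocket mass of `s` over pockets NOT containing `x` times the hijack mass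
`μ(s↔b, a₀↮s, x↔a₀)` is at most `μ(s↔b, a₀↮s, s↮x)` times the pocket mass re-weighted by `μ(x ↔ a₀ in Wᶜ)`.
Proof sketch (control-strategist g3): with `N₂ = {s ↮ a₀} ∩ {s ↮ x}`, BHK 2006 Thm 1.3 for the cluster of `s` given `s ↮ {a₀, x}`
twice — (i) `1{b ∈ C_s}` increasing vs `η(C_s) = μ(x ↔ a₀ off C_s)` antitone: `μ(N₂)·μ(win, x↔a₀) ≤ μ(win, s↮x)·∫_{N₂} η`;
(ii) the two antitone functions `ρ(C_s) = 1{C_s ∩ A = ∅}·min_A μ(a ↔ b off C_s)` and `η`: `(∫_{N₂} ρ)(∫_{N₂} η) ≤ μ(N₂)·∫_{N₂} ρη` —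
plus the pocket decoupling `μ(C(s) = W ∩ E) = μ(C(s) = W)·μ(E in Wᶜ)` for events `E` off `W`.  0 violations in ≈ 6 000 exact instances
(2–4 relays, n ≤ 8, every designation, glued blocks).
[cite: VandenbergHaggstromKahn2005, Thm. 1.3 (p. 6); KozmaNitzan2024, Lemma 1 (pp. 5–6), §3.2 pp. 12–14] -/
theorem stub_hijackSplitBHK :
    ∀ (n : ℕ) (u : Sym2 (Fin n) → unitInterval) (A : Finset (Fin n)) (b a₀ s x : Fin n) (hb : b ∈ A),
      a₀ ∈ A → s ∉ A → x ∉ A → s ≠ x →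
      (∑ W ∈ (Finset.univ : Finset (Finset (Fin n))).filter (fun W => (s ∈ W ∧ Disjoint W A) ∧ x ∉ W),
              (prodBernoulli u).real {ω : BondConfig (Fin n) | openCluster ω s = (W : Set (Fin n))}
                * A.inf' ⟨b, hb⟩ (fun a => (prodBernoulli u).real (openConnIn ((W : Set (Fin n))ᶜ) a b)))
        * (prodBernoulli u).real (openConn s b ∩ (openConn a₀ s)ᶜ ∩ openConn x a₀)
      ≤ (prodBernoulli u).real (openConn s b ∩ (openConn a₀ s)ᶜ ∩ (openConn s x)ᶜ)
        * (∑ W ∈ (Finset.univ : Finset (Finset (Fin n))).filter (fun W => (s ∈ W ∧ Disjoint W A) ∧ x ∉ W),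
              (prodBernoulli u).real {ω : BondConfig (Fin n) | openCluster ω s = (W : Set (Fin n))}
                * A.inf' ⟨b, hb⟩ (fun a => (prodBernoulli u).real (openConnIn ((W : Set (Fin n))ᶜ) a b))
                * (prodBernoulli u).real (openConnIn ((W : Set (Fin n))ᶜ) x a₀)) := by
  sorry

/-- **STUB B — FALSE AS STATED (witness: CONTROL-CENSUS C20); the SLOT of the template.**  Original description: the pair RESIDUAL `S2q` — what is left of the pair step after the BHK hijack bound.
`D(s)·(Z(s) − Z(S)) + Z_{x∈}(s)·Hij + WIN_{x∉}(s)·Zx(s) ≤ Z(s)·μ(s↮b, a₀↮s, x↔b)` for `S = {s, x}`, `s, x` bad, `a₀` the minimiser,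
given point goodness of `s` (`0 ≤ K(s)`, the induction hypothesis the peel chain already holds).  With STUB A and the identity STUB C this is
EXACTLY g0's `stub_ratioMonotonePair` (`ratioMonotonePair_of_split`, real proof): `K(S)Z(s) − K(s)Z(S) = S2q-slack + (A-slack)`.
Equivalent forms: `K(s)·(Z(s)−Z(S)) + Z(s)·(E₁ + IHV) ≥ Z_{x∈}·Hij + WIN_{x∉}·Zx` (`IHV` = pocket-wise goodness of `x`, `Z(s)−Z(S) = Ω − IHV`);
it contains Kozma–Nitzan's Lemma 5 (relay attachment) on the family `x` pendant to a non-designated relay and is an identity on `x` pendant to `a₀`.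
(random sampling saw 0 / 4 000 — it is blind near the identity family x ⊣ a₀; the exhaustive sweep and the glued-block sampler found the violations); also FALSE at
non-minimal designations (29 %) — it carries the whole `hmin` content of the pair step (cf. `additiveGluing_false_without_relay`).
[cite: KozmaNitzan2024, §3.2 Lemma 5 (p. 13), Question 7 (p. 36); VandenbergHaggstromKahn2005, Thms. 1.3–1.5 (pp. 6–7)] -/
theorem stub_pairResidual :
    ∀ (n : ℕ) (u : Sym2 (Fin n) → unitInterval) (A : Finset (Fin n)) (b a₀ s x : Fin n) (hb : b ∈ A),
      a₀ ∈ A → s ∉ A → x ∉ A → s ≠ x →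
      (∀ a ∈ A, (prodBernoulli u).real (openConn a₀ b) ≤ (prodBernoulli u).real (openConn a b)) →
      (prodBernoulli u).real (openConn s b) < (prodBernoulli u).real (openConn a₀ b) →
      (prodBernoulli u).real (openConn x b) < (prodBernoulli u).real (openConn a₀ b) →
      0 ≤ (prodBernoulli u).real (openConn s b)
          + (∑ W ∈ (Finset.univ : Finset (Finset (Fin n))).filter (fun W => s ∈ W ∧ Disjoint W A),
              (prodBernoulli u).real {ω : BondConfig (Fin n) | openCluster ω s = (W : Set (Fin n))}
                * A.inf' ⟨b, hb⟩ (fun a => (prodBernoulli u).real (openConnIn ((W : Set (Fin n))ᶜ) a b)))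
          - (prodBernoulli u).real (openConn a₀ b) →
      ((prodBernoulli u).real (openConn a₀ b) - (prodBernoulli u).real (openConn s b))
          * ((∑ W ∈ (Finset.univ : Finset (Finset (Fin n))).filter (fun W => s ∈ W ∧ Disjoint W A),
              (prodBernoulli u).real {ω : BondConfig (Fin n) | openCluster ω s = (W : Set (Fin n))}
                * A.inf' ⟨b, hb⟩ (fun a => (prodBernoulli u).real (openConnIn ((W : Set (Fin n))ᶜ) a b)))
            - (∑ W ∈ (Finset.univ : Finset (Finset (Fin n))).filter (fun W => Disjoint W A),
              (prodBernoulli u).real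
                  {ω : BondConfig (Fin n) | ∀ z : Fin n, (z ∈ W ↔ ω ∈ ⋃ v ∈ ({s, x} : Finset (Fin n)), openConn v z)}
                * A.inf' ⟨b, hb⟩ (fun a => (prodBernoulli u).real (openConnIn ((W : Set (Fin n))ᶜ) a b))))
        + (∑ W ∈ (Finset.univ : Finset (Finset (Fin n))).filter (fun W => (s ∈ W ∧ Disjoint W A) ∧ x ∈ W),
              (prodBernoulli u).real {ω : BondConfig (Fin n) | openCluster ω s = (W : Set (Fin n))}
                * A.inf' ⟨b, hb⟩ (fun a => (prodBernoulli u).real (openConnIn ((W : Set (Fin n))ᶜ) a b)))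
          * (prodBernoulli u).real (openConn s b ∩ (openConn a₀ s)ᶜ ∩ openConn x a₀)
        + (prodBernoulli u).real (openConn s b ∩ (openConn a₀ s)ᶜ ∩ (openConn s x)ᶜ)
          * (∑ W ∈ (Finset.univ : Finset (Finset (Fin n))).filter (fun W => (s ∈ W ∧ Disjoint W A) ∧ x ∉ W),
              (prodBernoulli u).real {ω : BondConfig (Fin n) | openCluster ω s = (W : Set (Fin n))}
                * A.inf' ⟨b, hb⟩ (fun a => (prodBernoulli u).real (openConnIn ((W : Set (Fin n))ᶜ) a b))
                * (prodBernoulli u).real (openConnIn ((W : Set (Fin n))ᶜ) x a₀))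
      ≤ (∑ W ∈ (Finset.univ : Finset (Finset (Fin n))).filter (fun W => s ∈ W ∧ Disjoint W A),
              (prodBernoulli u).real {ω : BondConfig (Fin n) | openCluster ω s = (W : Set (Fin n))}
                * A.inf' ⟨b, hb⟩ (fun a => (prodBernoulli u).real (openConnIn ((W : Set (Fin n))ᶜ) a b)))
        * (prodBernoulli u).real ((openConn s b)ᶜ ∩ (openConn a₀ s)ᶜ ∩ openConn x b) := by
  sorry

/-- **STUB C (NEW, S/M-sized bookkeeping, provable now): the gain identity of the pair step.**
`μ(S↔b) − μ(s↔b) − μ(a₀↮b, a₀↔S, S↔b) = μ(s↮b, a₀↮s, x↔b) − μ(s↔b, a₀↮s, x↔a₀)` for `S = {s, x}`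
(both sides = gain of the block minus the hijack; two disjoint-union identities on the configuration space).
[cite: KozmaNitzan2024, §3.2 pp. 12–14] -/
theorem stub_gainIdentity :
    ∀ (n : ℕ) (u : Sym2 (Fin n) → unitInterval) (A : Finset (Fin n)) (b a₀ s x : Fin n) (hb : b ∈ A),
      a₀ ∈ A → s ∉ A → x ∉ A → s ≠ x →
      (prodBernoulli u).real (⋃ v ∈ ({s, x} : Finset (Fin n)), openConn v b)
        - (prodBernoulli u).real (openConn s b)
        - (prodBernoulli u).real
              ((openConn a₀ b)ᶜ ∩ (⋃ v ∈ ({s, x} : Finset (Fin n)), openConn a₀ v) ∩ (⋃ v ∈ ({s, x} : Finset (Fin n)), openConn v b))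
      = (prodBernoulli u).real ((openConn s b)ᶜ ∩ (openConn a₀ s)ᶜ ∩ openConn x b)
        - (prodBernoulli u).real (openConn s b ∩ (openConn a₀ s)ᶜ ∩ openConn x a₀) := by
  sorry

/-- **STUB 2 (load-bearing, NEW): PEEL — ratio monotonicity of a BLOCK, one vertex at a time.**  `u`, relays `A ∋ b`, minimiser
`a₀`, a block `T` disjoint from `A` with `2 ≤ T.card` whose glued deficit is positive (`μ(T↔b) < μ(a₀↔b) + μ(a₀↮b, a₀↔T, T↔b)`), and a
vertex `x ∉ A ∪ T`:  `D_{T∪x} · Z_T ≤ D_T · Z_{T∪x}` (pocket mass per unit deficit does not drop when `x` is glued on).  Together with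
STUB 1 (`T` a point) this is every step of the chain `{s} ⊂ … ⊂ S`; it is `stub_ratioEdgeMono` of line `ratio-star` at 0/1 prefix weights.
[cite: KozmaNitzan2024, §3.2 pp. 12–14, §5.3 p. 34, Question 9 p. 36] -/
theorem stub_peel :
    ∀ (n : ℕ) (u : Sym2 (Fin n) → unitInterval) (A T : Finset (Fin n)) (b a₀ x : Fin n) (hb : b ∈ A),
      Disjoint T A → 2 ≤ T.card → x ∉ A → x ∉ T → a₀ ∈ A →
      (∀ a ∈ A, (prodBernoulli u).real (openConn a₀ b) ≤ (prodBernoulli u).real (openConn a b)) →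
      (prodBernoulli u).real (⋃ v ∈ T, openConn v b)
        < (prodBernoulli u).real (openConn a₀ b)
          + (prodBernoulli u).real
              ((openConn a₀ b)ᶜ ∩ (⋃ v ∈ T, openConn a₀ v) ∩ (⋃ v ∈ T, openConn v b)) →
      ((prodBernoulli u).real (openConn a₀ b)
          + (prodBernoulli u).real
              ((openConn a₀ b)ᶜ ∩ (⋃ v ∈ insert x T, openConn a₀ v) ∩ (⋃ v ∈ insert x T, openConn v b))
          - (prodBernoulli u).real (⋃ v ∈ insert x T, openConn v b))
        * (∑ W ∈ (Finset.univ : Finset (Finset (Fin n))).filter (fun W => Disjoint W A),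
              (prodBernoulli u).real
                  {ω : BondConfig (Fin n) | ∀ z : Fin n, (z ∈ W ↔ ω ∈ ⋃ v ∈ T, openConn v z)}
                * A.inf' ⟨b, hb⟩ (fun a => (prodBernoulli u).real (openConnIn ((W : Set (Fin n))ᶜ) a b)))
      ≤ ((prodBernoulli u).real (openConn a₀ b)
          + (prodBernoulli u).real
              ((openConn a₀ b)ᶜ ∩ (⋃ v ∈ T, openConn a₀ v) ∩ (⋃ v ∈ T, openConn v b))
          - (prodBernoulli u).real (⋃ v ∈ T, openConn v b))
        * (∑ W ∈ (Finset.univ : Finset (Finset (Fin n))).filter (fun W => Disjoint W A),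
              (prodBernoulli u).real
                  {ω : BondConfig (Fin n) | ∀ z : Fin n, (z ∈ W ↔ ω ∈ ⋃ v ∈ insert x T, openConn v z)}
                * A.inf' ⟨b, hb⟩ (fun a => (prodBernoulli u).real (openConnIn ((W : Set (Fin n))ᶜ) a b))) := by
  sorry

/-- **STUB 3 (NEW, M): good blocks stay good.**  For any block `T ∌ a₀` and any vertex `x`: `D_T ≤ 0 ⟹ D_{T∪x} ≤ 0`
(`P(a₀ wins ∣ a₀ ↮ T∪x) ≤ P(a₀ wins ∣ a₀ ↮ T)` by BHK 2006 Thm 1.3, `P(T∪x wins ∣ a₀ ↮ T∪x) ≥ P(T wins ∣ a₀ ↮ T)` by the master inequality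
`winsDominate`). [cite: VandenbergHaggstromKahn2005, Thm. 1.3 (p. 6), Thm. 1.4 (p. 7); KozmaNitzan2024, Lemma 1 (pp. 5–6)] -/
theorem stub_goodStaysGoodBlock :
    ∀ (n : ℕ) (u : Sym2 (Fin n) → unitInterval) (T : Finset (Fin n)) (b a₀ x : Fin n),
      a₀ ∉ T →
      (prodBernoulli u).real (openConn a₀ b)
          + (prodBernoulli u).real
              ((openConn a₀ b)ᶜ ∩ (⋃ v ∈ T, openConn a₀ v) ∩ (⋃ v ∈ T, openConn v b))
        ≤ (prodBernoulli u).real (⋃ v ∈ T, openConn v b) →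
      (prodBernoulli u).real (openConn a₀ b)
          + (prodBernoulli u).real
              ((openConn a₀ b)ᶜ ∩ (⋃ v ∈ insert x T, openConn a₀ v) ∩ (⋃ v ∈ insert x T, openConn v b))
        ≤ (prodBernoulli u).real (⋃ v ∈ insert x T, openConn v b) := by
  sorry

/-! ## Real proofs -/

variable {n : ℕ}

/-- Splitting a pocket sum of the point `s` according to whether the pocket contains `x`. [folklore] -/
theorem pocketSum_split (u : Sym2 (Fin n) → unitInterval) (A : Finset (Fin n)) (b s x : Fin n) (hb : b ∈ A) :
    (∑ W ∈ (Finset.univ : Finset (Finset (Fin n))).filter (fun W => s ∈ W ∧ Disjoint W A),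
              (prodBernoulli u).real {ω : BondConfig (Fin n) | openCluster ω s = (W : Set (Fin n))}
                * A.inf' ⟨b, hb⟩ (fun a => (prodBernoulli u).real (openConnIn ((W : Set (Fin n))ᶜ) a b)))
      = (∑ W ∈ (Finset.univ : Finset (Finset (Fin n))).filter (fun W => (s ∈ W ∧ Disjoint W A) ∧ x ∈ W),
              (prodBernoulli u).real {ω : BondConfig (Fin n) | openCluster ω s = (W : Set (Fin n))}
                * A.inf' ⟨b, hb⟩ (fun a => (prodBernoulli u).real (openConnIn ((W : Set (Fin n))ᶜ) a b)))
        + (∑ W ∈ (Finset.univ : Finset (Finset (Fin n))).filter (fun W => (s ∈ W ∧ Disjoint W A) ∧ x ∉ W),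
              (prodBernoulli u).real {ω : BondConfig (Fin n) | openCluster ω s = (W : Set (Fin n))}
                * A.inf' ⟨b, hb⟩ (fun a => (prodBernoulli u).real (openConnIn ((W : Set (Fin n))ᶜ) a b))) := by
  rw [← Finset.sum_filter_add_sum_filter_not
    ((Finset.univ : Finset (Finset (Fin n))).filter (fun W => s ∈ W ∧ Disjoint W A)) (fun W => x ∈ W)]
  rw [Finset.filter_filter, Finset.filter_filter]

/-- **The pair step from the split** (real proof): STUB A + STUB B + STUB C give g0's registered `stub_ratioMonotonePair`
(with the point-goodness hypothesis `0 ≤ K(s)` that the peel chain supplies). -/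
theorem ratioMonotonePair_of_split
    (hA : ∀ (n : ℕ) (u : Sym2 (Fin n) → unitInterval) (A : Finset (Fin n)) (b a₀ s x : Fin n) (hb : b ∈ A),
      a₀ ∈ A → s ∉ A → x ∉ A → s ≠ x →
      (∑ W ∈ (Finset.univ : Finset (Finset (Fin n))).filter (fun W => (s ∈ W ∧ Disjoint W A) ∧ x ∉ W),
              (prodBernoulli u).real {ω : BondConfig (Fin n) | openCluster ω s = (W : Set (Fin n))}
                * A.inf' ⟨b, hb⟩ (fun a => (prodBernoulli u).real (openConnIn ((W : Set (Fin n))ᶜ) a b)))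
        * (prodBernoulli u).real (openConn s b ∩ (openConn a₀ s)ᶜ ∩ openConn x a₀)
      ≤ (prodBernoulli u).real (openConn s b ∩ (openConn a₀ s)ᶜ ∩ (openConn s x)ᶜ)
        * (∑ W ∈ (Finset.univ : Finset (Finset (Fin n))).filter (fun W => (s ∈ W ∧ Disjoint W A) ∧ x ∉ W),
              (prodBernoulli u).real {ω : BondConfig (Fin n) | openCluster ω s = (W : Set (Fin n))}
                * A.inf' ⟨b, hb⟩ (fun a => (prodBernoulli u).real (openConnIn ((W : Set (Fin n))ᶜ) a b))
                * (prodBernoulli u).real (openConnIn ((W : Set (Fin n))ᶜ) x a₀)))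
    (hB : ∀ (n : ℕ) (u : Sym2 (Fin n) → unitInterval) (A : Finset (Fin n)) (b a₀ s x : Fin n) (hb : b ∈ A),
      a₀ ∈ A → s ∉ A → x ∉ A → s ≠ x →
      (∀ a ∈ A, (prodBernoulli u).real (openConn a₀ b) ≤ (prodBernoulli u).real (openConn a b)) →
      (prodBernoulli u).real (openConn s b) < (prodBernoulli u).real (openConn a₀ b) →
      (prodBernoulli u).real (openConn x b) < (prodBernoulli u).real (openConn a₀ b) →
      0 ≤ (prodBernoulli u).real (openConn s b)
          + (∑ W ∈ (Finset.univ : Finset (Finset (Fin n))).filter (fun W => s ∈ W ∧ Disjoint W A),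
              (prodBernoulli u).real {ω : BondConfig (Fin n) | openCluster ω s = (W : Set (Fin n))}
                * A.inf' ⟨b, hb⟩ (fun a => (prodBernoulli u).real (openConnIn ((W : Set (Fin n))ᶜ) a b)))
          - (prodBernoulli u).real (openConn a₀ b) →
      ((prodBernoulli u).real (openConn a₀ b) - (prodBernoulli u).real (openConn s b))
          * ((∑ W ∈ (Finset.univ : Finset (Finset (Fin n))).filter (fun W => s ∈ W ∧ Disjoint W A),
              (prodBernoulli u).real {ω : BondConfig (Fin n) | openCluster ω s = (W : Set (Fin n))}
                * A.inf' ⟨b, hb⟩ (fun a => (prodBernoulli u).real (openConnIn ((W : Set (Fin n))ᶜ) a b)))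
            - (∑ W ∈ (Finset.univ : Finset (Finset (Fin n))).filter (fun W => Disjoint W A),
              (prodBernoulli u).real
                  {ω : BondConfig (Fin n) | ∀ z : Fin n, (z ∈ W ↔ ω ∈ ⋃ v ∈ ({s, x} : Finset (Fin n)), openConn v z)}
                * A.inf' ⟨b, hb⟩ (fun a => (prodBernoulli u).real (openConnIn ((W : Set (Fin n))ᶜ) a b))))
        + (∑ W ∈ (Finset.univ : Finset (Finset (Fin n))).filter (fun W => (s ∈ W ∧ Disjoint W A) ∧ x ∈ W),
              (prodBernoulli u).real {ω : BondConfig (Fin n) | openCluster ω s = (W : Set (Fin n))}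
                * A.inf' ⟨b, hb⟩ (fun a => (prodBernoulli u).real (openConnIn ((W : Set (Fin n))ᶜ) a b)))
          * (prodBernoulli u).real (openConn s b ∩ (openConn a₀ s)ᶜ ∩ openConn x a₀)
        + (prodBernoulli u).real (openConn s b ∩ (openConn a₀ s)ᶜ ∩ (openConn s x)ᶜ)
          * (∑ W ∈ (Finset.univ : Finset (Finset (Fin n))).filter (fun W => (s ∈ W ∧ Disjoint W A) ∧ x ∉ W),
              (prodBernoulli u).real {ω : BondConfig (Fin n) | openCluster ω s = (W : Set (Fin n))}
                * A.inf' ⟨b, hb⟩ (fun a => (prodBernoulli u).real (openConnIn ((W : Set (Fin n))ᶜ) a b))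
                * (prodBernoulli u).real (openConnIn ((W : Set (Fin n))ᶜ) x a₀))
      ≤ (∑ W ∈ (Finset.univ : Finset (Finset (Fin n))).filter (fun W => s ∈ W ∧ Disjoint W A),
              (prodBernoulli u).real {ω : BondConfig (Fin n) | openCluster ω s = (W : Set (Fin n))}
                * A.inf' ⟨b, hb⟩ (fun a => (prodBernoulli u).real (openConnIn ((W : Set (Fin n))ᶜ) a b)))
        * (prodBernoulli u).real ((openConn s b)ᶜ ∩ (openConn a₀ s)ᶜ ∩ openConn x b))
    (hC : ∀ (n : ℕ) (u : Sym2 (Fin n) → unitInterval) (A : Finset (Fin n)) (b a₀ s x : Fin n) (hb : b ∈ A),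
      a₀ ∈ A → s ∉ A → x ∉ A → s ≠ x →
      (prodBernoulli u).real (⋃ v ∈ ({s, x} : Finset (Fin n)), openConn v b)
        - (prodBernoulli u).real (openConn s b)
        - (prodBernoulli u).real
              ((openConn a₀ b)ᶜ ∩ (⋃ v ∈ ({s, x} : Finset (Fin n)), openConn a₀ v) ∩ (⋃ v ∈ ({s, x} : Finset (Fin n)), openConn v b))
      = (prodBernoulli u).real ((openConn s b)ᶜ ∩ (openConn a₀ s)ᶜ ∩ openConn x b)
        - (prodBernoulli u).real (openConn s b ∩ (openConn a₀ s)ᶜ ∩ openConn x a₀)) :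
    ∀ (n : ℕ) (u : Sym2 (Fin n) → unitInterval) (A S : Finset (Fin n)) (b a₀ s : Fin n) (hb : b ∈ A),
      Disjoint S A → s ∈ S → a₀ ∈ A →
      (∀ a ∈ A, (prodBernoulli u).real (openConn a₀ b) ≤ (prodBernoulli u).real (openConn a b)) →
      (∀ v ∈ S, (prodBernoulli u).real (openConn v b) < (prodBernoulli u).real (openConn a₀ b)) →
      S.card = 2 →
      0 ≤ (prodBernoulli u).real (openConn s b)
          + (∑ W ∈ (Finset.univ : Finset (Finset (Fin n))).filter (fun W => s ∈ W ∧ Disjoint W A),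
              (prodBernoulli u).real {ω : BondConfig (Fin n) | openCluster ω s = (W : Set (Fin n))}
                * A.inf' ⟨b, hb⟩ (fun a => (prodBernoulli u).real (openConnIn ((W : Set (Fin n))ᶜ) a b)))
          - (prodBernoulli u).real (openConn a₀ b) →
      ((prodBernoulli u).real (openConn s b)
          + (∑ W ∈ (Finset.univ : Finset (Finset (Fin n))).filter (fun W => s ∈ W ∧ Disjoint W A),
              (prodBernoulli u).real {ω : BondConfig (Fin n) | openCluster ω s = (W : Set (Fin n))}
                * A.inf' ⟨b, hb⟩ (fun a => (prodBernoulli u).real (openConnIn ((W : Set (Fin n))ᶜ) a b)))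
          - (prodBernoulli u).real (openConn a₀ b))
        * (∑ W ∈ (Finset.univ : Finset (Finset (Fin n))).filter (fun W => Disjoint W A),
              (prodBernoulli u).real
                  {ω : BondConfig (Fin n) | ∀ z : Fin n, (z ∈ W ↔ ω ∈ ⋃ v ∈ S, openConn v z)}
                * A.inf' ⟨b, hb⟩ (fun a => (prodBernoulli u).real (openConnIn ((W : Set (Fin n))ᶜ) a b)))
      ≤ ((prodBernoulli u).real (⋃ v ∈ S, openConn v b)
          + (∑ W ∈ (Finset.univ : Finset (Finset (Fin n))).filter (fun W => Disjoint W A),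
              (prodBernoulli u).real
                  {ω : BondConfig (Fin n) | ∀ z : Fin n, (z ∈ W ↔ ω ∈ ⋃ v ∈ S, openConn v z)}
                * A.inf' ⟨b, hb⟩ (fun a => (prodBernoulli u).real (openConnIn ((W : Set (Fin n))ᶜ) a b)))
          - (prodBernoulli u).real (openConn a₀ b)
          - (prodBernoulli u).real
              ((openConn a₀ b)ᶜ ∩ (⋃ v ∈ S, openConn a₀ v) ∩ (⋃ v ∈ S, openConn v b)))
        * (∑ W ∈ (Finset.univ : Finset (Finset (Fin n))).filter (fun W => s ∈ W ∧ Disjoint W A),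
              (prodBernoulli u).real {ω : BondConfig (Fin n) | openCluster ω s = (W : Set (Fin n))}
                * A.inf' ⟨b, hb⟩ (fun a => (prodBernoulli u).real (openConnIn ((W : Set (Fin n))ᶜ) a b))) := by
  intro n u A S b a₀ s hb hSA hsS ha₀ hmin hbad hS2 hK
  classical
  obtain ⟨p, q, hpq, rfl⟩ := Finset.card_eq_two.1 hS2
  -- name the second vertex `x` with `S = {s, x}`
  have hsx : ∃ x : Fin n, s ≠ x ∧ ({p, q} : Finset (Fin n)) = {s, x} := by
    rcases Finset.mem_insert.1 hsS with rfl | hq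
    · exact ⟨q, hpq, rfl⟩
    · rw [Finset.mem_singleton] at hq
      subst hq
      exact ⟨p, fun h => hpq h.symm, Finset.pair_comm p s⟩
  obtain ⟨x, hsx, hSx⟩ := hsx
  rw [hSx] at hSA hbad ⊢
  have hsA : s ∉ A := Finset.disjoint_left.1 hSA (Finset.mem_insert_self s {x})
  have hxA : x ∉ A := Finset.disjoint_left.1 hSA (Finset.mem_insert_of_mem (Finset.mem_singleton_self x))
  have hs_bad := hbad s (Finset.mem_insert_self s {x})
  have hx_bad := hbad x (Finset.mem_insert_of_mem (Finset.mem_singleton_self x))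
  have hA' := hA n u A b a₀ s x hb ha₀ hsA hxA hsx
  have hB' := hB n u A b a₀ s x hb ha₀ hsA hxA hsx hmin hs_bad hx_bad hK
  have hC' := hC n u A b a₀ s x hb ha₀ hsA hxA hsx
  have hsplit := pocketSum_split u A b s x hb
  -- abbreviate the eleven real numbers and conclude by (nonlinear) arithmetic on the identities
  set Zs := (∑ W ∈ (Finset.univ : Finset (Finset (Fin n))).filter (fun W => s ∈ W ∧ Disjoint W A),
              (prodBernoulli u).real {ω : BondConfig (Fin n) | openCluster ω s = (W : Set (Fin n))}
                * A.inf' ⟨b, hb⟩ (fun a => (prodBernoulli u).real (openConnIn ((W : Set (Fin n))ᶜ) a b))) with hZs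
  set Zi := (∑ W ∈ (Finset.univ : Finset (Finset (Fin n))).filter (fun W => (s ∈ W ∧ Disjoint W A) ∧ x ∈ W),
              (prodBernoulli u).real {ω : BondConfig (Fin n) | openCluster ω s = (W : Set (Fin n))}
                * A.inf' ⟨b, hb⟩ (fun a => (prodBernoulli u).real (openConnIn ((W : Set (Fin n))ᶜ) a b))) with hZi
  set Zo := (∑ W ∈ (Finset.univ : Finset (Finset (Fin n))).filter (fun W => (s ∈ W ∧ Disjoint W A) ∧ x ∉ W),
              (prodBernoulli u).real {ω : BondConfig (Fin n) | openCluster ω s = (W : Set (Fin n))}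
                * A.inf' ⟨b, hb⟩ (fun a => (prodBernoulli u).real (openConnIn ((W : Set (Fin n))ᶜ) a b))) with hZo
  set Zx := (∑ W ∈ (Finset.univ : Finset (Finset (Fin n))).filter (fun W => (s ∈ W ∧ Disjoint W A) ∧ x ∉ W),
              (prodBernoulli u).real {ω : BondConfig (Fin n) | openCluster ω s = (W : Set (Fin n))}
                * A.inf' ⟨b, hb⟩ (fun a => (prodBernoulli u).real (openConnIn ((W : Set (Fin n))ᶜ) a b))
                * (prodBernoulli u).real (openConnIn ((W : Set (Fin n))ᶜ) x a₀)) with hZxdef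
  set ZS := (∑ W ∈ (Finset.univ : Finset (Finset (Fin n))).filter (fun W => Disjoint W A),
              (prodBernoulli u).real
                  {ω : BondConfig (Fin n) | ∀ z : Fin n, (z ∈ W ↔ ω ∈ ⋃ v ∈ ({s, x} : Finset (Fin n)), openConn v z)}
                * A.inf' ⟨b, hb⟩ (fun a => (prodBernoulli u).real (openConnIn ((W : Set (Fin n))ᶜ) a b))) with hZS
  set Hj := (prodBernoulli u).real (openConn s b ∩ (openConn a₀ s)ᶜ ∩ openConn x a₀) with hHj
  set Wo := (prodBernoulli u).real (openConn s b ∩ (openConn a₀ s)ᶜ ∩ (openConn s x)ᶜ) with hWo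
  set OE := (prodBernoulli u).real ((openConn s b)ᶜ ∩ (openConn a₀ s)ᶜ ∩ openConn x b) with hOE
  set HS := (prodBernoulli u).real
              ((openConn a₀ b)ᶜ ∩ (⋃ v ∈ ({s, x} : Finset (Fin n)), openConn a₀ v) ∩ (⋃ v ∈ ({s, x} : Finset (Fin n)), openConn v b)) with hHS
  set tS := (prodBernoulli u).real (⋃ v ∈ ({s, x} : Finset (Fin n)), openConn v b) with htS
  set ts := (prodBernoulli u).real (openConn s b) with hts
  set ta := (prodBernoulli u).real (openConn a₀ b) with hta
  have hZo_nn : 0 ≤ Zo := by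
    rw [hZo]
    exact Finset.sum_nonneg fun W _ => mul_nonneg measureReal_nonneg (Finset.le_inf' _ _ fun a _ => measureReal_nonneg)
  have key : (tS + ZS - ta - HS) * Zs - (ts + Zs - ta) * ZS
      = (Zs * OE - ((ta - ts) * (Zs - ZS) + Zi * Hj + Wo * Zx)) + (Wo * Zx - Zo * Hj) := by
    linear_combination Zs * hC' - Hj * hsplit
  nlinarith [key, hA', hB', hZo_nn]

/-- **Block goodness from the three stubs and goodness of one point of the block** (strong induction on the size of a sub-block
`T ∋ s`; base `|T| = 2` = g0's `blockGood_of_ratio` argument; step PEEL / goodStaysGood). -/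
theorem blockGood_of_peel (u : Sym2 (Fin n) → unitInterval) (A S : Finset (Fin n)) (b a₀ s : Fin n)
    (sel : Finset (Fin n) → Fin n) (hb : b ∈ A) (hsel : ∀ W, sel W ∈ A) (hSA : Disjoint S A) (hs : s ∈ S) (h2 : 2 ≤ S.card)
    (ha₀ : a₀ ∈ A)
    (hmin : ∀ a ∈ A, (prodBernoulli u).real (openConn a₀ b) ≤ (prodBernoulli u).real (openConn a b))
    (hbad : ∀ v ∈ S, (prodBernoulli u).real (openConn v b) < (prodBernoulli u).real (openConn a₀ b))
    (hpair : ∀ (n : ℕ) (u : Sym2 (Fin n) → unitInterval) (A S : Finset (Fin n)) (b a₀ s : Fin n) (hb : b ∈ A),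
      Disjoint S A → s ∈ S → a₀ ∈ A →
      (∀ a ∈ A, (prodBernoulli u).real (openConn a₀ b) ≤ (prodBernoulli u).real (openConn a b)) →
      (∀ v ∈ S, (prodBernoulli u).real (openConn v b) < (prodBernoulli u).real (openConn a₀ b)) →
      S.card = 2 →
      0 ≤ (prodBernoulli u).real (openConn s b)
          + (∑ W ∈ (Finset.univ : Finset (Finset (Fin n))).filter (fun W => s ∈ W ∧ Disjoint W A),
              (prodBernoulli u).real {ω : BondConfig (Fin n) | openCluster ω s = (W : Set (Fin n))}
                * A.inf' ⟨b, hb⟩ (fun a => (prodBernoulli u).real (openConnIn ((W : Set (Fin n))ᶜ) a b)))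
          - (prodBernoulli u).real (openConn a₀ b) →
      ((prodBernoulli u).real (openConn s b)
          + (∑ W ∈ (Finset.univ : Finset (Finset (Fin n))).filter (fun W => s ∈ W ∧ Disjoint W A),
              (prodBernoulli u).real {ω : BondConfig (Fin n) | openCluster ω s = (W : Set (Fin n))}
                * A.inf' ⟨b, hb⟩ (fun a => (prodBernoulli u).real (openConnIn ((W : Set (Fin n))ᶜ) a b)))
          - (prodBernoulli u).real (openConn a₀ b))
        * (∑ W ∈ (Finset.univ : Finset (Finset (Fin n))).filter (fun W => Disjoint W A),
              (prodBernoulli u).real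
                  {ω : BondConfig (Fin n) | ∀ z : Fin n, (z ∈ W ↔ ω ∈ ⋃ v ∈ S, openConn v z)}
                * A.inf' ⟨b, hb⟩ (fun a => (prodBernoulli u).real (openConnIn ((W : Set (Fin n))ᶜ) a b)))
      ≤ ((prodBernoulli u).real (⋃ v ∈ S, openConn v b)
          + (∑ W ∈ (Finset.univ : Finset (Finset (Fin n))).filter (fun W => Disjoint W A),
              (prodBernoulli u).real
                  {ω : BondConfig (Fin n) | ∀ z : Fin n, (z ∈ W ↔ ω ∈ ⋃ v ∈ S, openConn v z)}
                * A.inf' ⟨b, hb⟩ (fun a => (prodBernoulli u).real (openConnIn ((W : Set (Fin n))ᶜ) a b)))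
          - (prodBernoulli u).real (openConn a₀ b)
          - (prodBernoulli u).real
              ((openConn a₀ b)ᶜ ∩ (⋃ v ∈ S, openConn a₀ v) ∩ (⋃ v ∈ S, openConn v b)))
        * (∑ W ∈ (Finset.univ : Finset (Finset (Fin n))).filter (fun W => s ∈ W ∧ Disjoint W A),
              (prodBernoulli u).real {ω : BondConfig (Fin n) | openCluster ω s = (W : Set (Fin n))}
                * A.inf' ⟨b, hb⟩ (fun a => (prodBernoulli u).real (openConnIn ((W : Set (Fin n))ᶜ) a b))))
    (hpeel : ∀ (n : ℕ) (u : Sym2 (Fin n) → unitInterval) (A T : Finset (Fin n)) (b a₀ x : Fin n) (hb : b ∈ A),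
      Disjoint T A → 2 ≤ T.card → x ∉ A → x ∉ T → a₀ ∈ A →
      (∀ a ∈ A, (prodBernoulli u).real (openConn a₀ b) ≤ (prodBernoulli u).real (openConn a b)) →
      (prodBernoulli u).real (⋃ v ∈ T, openConn v b)
        < (prodBernoulli u).real (openConn a₀ b)
          + (prodBernoulli u).real
              ((openConn a₀ b)ᶜ ∩ (⋃ v ∈ T, openConn a₀ v) ∩ (⋃ v ∈ T, openConn v b)) →
      ((prodBernoulli u).real (openConn a₀ b)
          + (prodBernoulli u).real
              ((openConn a₀ b)ᶜ ∩ (⋃ v ∈ insert x T, openConn a₀ v) ∩ (⋃ v ∈ insert x T, openConn v b))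
          - (prodBernoulli u).real (⋃ v ∈ insert x T, openConn v b))
        * (∑ W ∈ (Finset.univ : Finset (Finset (Fin n))).filter (fun W => Disjoint W A),
              (prodBernoulli u).real
                  {ω : BondConfig (Fin n) | ∀ z : Fin n, (z ∈ W ↔ ω ∈ ⋃ v ∈ T, openConn v z)}
                * A.inf' ⟨b, hb⟩ (fun a => (prodBernoulli u).real (openConnIn ((W : Set (Fin n))ᶜ) a b)))
      ≤ ((prodBernoulli u).real (openConn a₀ b)
          + (prodBernoulli u).real
              ((openConn a₀ b)ᶜ ∩ (⋃ v ∈ T, openConn a₀ v) ∩ (⋃ v ∈ T, openConn v b))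
          - (prodBernoulli u).real (⋃ v ∈ T, openConn v b))
        * (∑ W ∈ (Finset.univ : Finset (Finset (Fin n))).filter (fun W => Disjoint W A),
              (prodBernoulli u).real
                  {ω : BondConfig (Fin n) | ∀ z : Fin n, (z ∈ W ↔ ω ∈ ⋃ v ∈ insert x T, openConn v z)}
                * A.inf' ⟨b, hb⟩ (fun a => (prodBernoulli u).real (openConnIn ((W : Set (Fin n))ᶜ) a b))))
    (hgsg : ∀ (n : ℕ) (u : Sym2 (Fin n) → unitInterval) (T : Finset (Fin n)) (b a₀ x : Fin n),
      a₀ ∉ T →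
      (prodBernoulli u).real (openConn a₀ b)
          + (prodBernoulli u).real
              ((openConn a₀ b)ᶜ ∩ (⋃ v ∈ T, openConn a₀ v) ∩ (⋃ v ∈ T, openConn v b))
        ≤ (prodBernoulli u).real (⋃ v ∈ T, openConn v b) →
      (prodBernoulli u).real (openConn a₀ b)
          + (prodBernoulli u).real
              ((openConn a₀ b)ᶜ ∩ (⋃ v ∈ insert x T, openConn a₀ v) ∩ (⋃ v ∈ insert x T, openConn v b))
        ≤ (prodBernoulli u).real (⋃ v ∈ insert x T, openConn v b))
    (hgood : (∀ (t : ℝ) (sel' : Finset (Fin n) → Fin n), (∀ W, sel' W ∈ A) →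
      (∀ a ∈ A, 1 - t ≤ (prodBernoulli u).real (openConn a b)) →
      (prodBernoulli u).real ((⋃ a ∈ A, openConn s a) ∩ (openConn s b)ᶜ)
        + ∑ W ∈ (Finset.univ : Finset (Finset (Fin n))).filter (fun W => s ∈ W ∧ Disjoint W A),
            (prodBernoulli u).real {ω : BondConfig (Fin n) | openCluster ω s = (W : Set (Fin n))}
              * (prodBernoulli u).real (openConnIn ((W : Set (Fin n))ᶜ) (sel' W) b)ᶜ ≤ t)) :
    (prodBernoulli u).real (openConn a₀ b)
        + (prodBernoulli u).real
              ((openConn a₀ b)ᶜ ∩ (⋃ v ∈ S, openConn a₀ v) ∩ (⋃ v ∈ S, openConn v b))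
      ≤ (prodBernoulli u).real (⋃ v ∈ S, openConn v b)
        + ∑ W ∈ (Finset.univ : Finset (Finset (Fin n))).filter (fun W => Disjoint W A),
            (prodBernoulli u).real {ω : BondConfig (Fin n) | ∀ z : Fin n, (z ∈ W ↔ ω ∈ ⋃ v ∈ S, openConn v z)}
              * (prodBernoulli u).real (openConnIn ((W : Set (Fin n))ᶜ) (sel W) b) := by
  -- goodness of the point `s` with the worst selection, in success form (as in `blockGood_of_ratio`)
  have hex : ∀ W : Finset (Fin n), ∃ a, a ∈ A ∧
      A.inf' ⟨b, hb⟩ (fun a => (prodBernoulli u).real (openConnIn ((W : Set (Fin n))ᶜ) a b)) =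
        (prodBernoulli u).real (openConnIn ((W : Set (Fin n))ᶜ) a b) :=
    fun W => Finset.exists_mem_eq_inf' ⟨b, hb⟩ _
  choose selm hselmA hselm using hex
  have hpt := hgood (1 - (prodBernoulli u).real (openConn a₀ b)) selm hselmA (fun a ha => by linarith [hmin a ha])
  rw [goodStep24_functional_eq u A s b hb selm] at hpt
  have hZpt_eq : ∑ W ∈ (Finset.univ : Finset (Finset (Fin n))).filter (fun W => s ∈ W ∧ Disjoint W A),
      (prodBernoulli u).real {ω : BondConfig (Fin n) | openCluster ω s = (W : Set (Fin n))}
        * (prodBernoulli u).real (openConnIn ((W : Set (Fin n))ᶜ) (selm W) b) = (∑ W ∈ (Finset.univ : Finset (Finset (Fin n))).filter (fun W => s ∈ W ∧ Disjoint W A),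
              (prodBernoulli u).real {ω : BondConfig (Fin n) | openCluster ω s = (W : Set (Fin n))}
                * A.inf' ⟨b, hb⟩ (fun a => (prodBernoulli u).real (openConnIn ((W : Set (Fin n))ᶜ) a b))) := by
    refine Finset.sum_congr rfl fun W _ => ?_
    rw [hselm W]
  rw [hZpt_eq] at hpt
  have hKpt : 0 ≤ (prodBernoulli u).real (openConn s b) + (∑ W ∈ (Finset.univ : Finset (Finset (Fin n))).filter (fun W => s ∈ W ∧ Disjoint W A),
              (prodBernoulli u).real {ω : BondConfig (Fin n) | openCluster ω s = (W : Set (Fin n))}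
                * A.inf' ⟨b, hb⟩ (fun a => (prodBernoulli u).real (openConnIn ((W : Set (Fin n))ᶜ) a b))) - (prodBernoulli u).real (openConn a₀ b) := by
    linarith
  have hinf_nonneg : ∀ W : Finset (Fin n),
      0 ≤ A.inf' ⟨b, hb⟩ (fun a => (prodBernoulli u).real (openConnIn ((W : Set (Fin n))ᶜ) a b)) :=
    fun W => Finset.le_inf' _ _ fun a _ => measureReal_nonneg
  have hZnn : ∀ T : Finset (Fin n), 0 ≤ (∑ W ∈ (Finset.univ : Finset (Finset (Fin n))).filter (fun W => Disjoint W A),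
              (prodBernoulli u).real
                  {ω : BondConfig (Fin n) | ∀ z : Fin n, (z ∈ W ↔ ω ∈ ⋃ v ∈ T, openConn v z)}
                * A.inf' ⟨b, hb⟩ (fun a => (prodBernoulli u).real (openConnIn ((W : Set (Fin n))ᶜ) a b))) :=
    fun T => Finset.sum_nonneg fun W _ => mul_nonneg measureReal_nonneg (hinf_nonneg W)
  -- the chain: every sub-block `T ∋ s` of `S` with at least two vertices is good (worst selection)
  have hchain : ∀ (m : ℕ) (T : Finset (Fin n)), T ⊆ S → s ∈ T → 2 ≤ T.card → T.card = m →
      (prodBernoulli u).real (openConn a₀ b)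
          + (prodBernoulli u).real
              ((openConn a₀ b)ᶜ ∩ (⋃ v ∈ T, openConn a₀ v) ∩ (⋃ v ∈ T, openConn v b))
        ≤ (prodBernoulli u).real (⋃ v ∈ T, openConn v b)
          + (∑ W ∈ (Finset.univ : Finset (Finset (Fin n))).filter (fun W => Disjoint W A),
              (prodBernoulli u).real
                  {ω : BondConfig (Fin n) | ∀ z : Fin n, (z ∈ W ↔ ω ∈ ⋃ v ∈ T, openConn v z)}
                * A.inf' ⟨b, hb⟩ (fun a => (prodBernoulli u).real (openConnIn ((W : Set (Fin n))ᶜ) a b))) := by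
    intro m
    induction m using Nat.strong_induction_on with
    | _ m ih =>
      intro T hTS hsT hT2 hTm
      have hTA : Disjoint T A := Finset.disjoint_of_subset_left hTS hSA
      by_cases hT3 : T.card = 2
      · -- base: the pair step from the point `s`
        have hRM := hpair n u A T b a₀ s hb hTA hsT ha₀ hmin (fun v hv => hbad v (hTS hv)) hT3 hKpt
        have hZpt_pos_or := hKpt
        by_contra hneg
        push Not at hneg
        have hZpt_pos : 0 < (∑ W ∈ (Finset.univ : Finset (Finset (Fin n))).filter (fun W => s ∈ W ∧ Disjoint W A),
              (prodBernoulli u).real {ω : BondConfig (Fin n) | openCluster ω s = (W : Set (Fin n))}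
                * A.inf' ⟨b, hb⟩ (fun a => (prodBernoulli u).real (openConnIn ((W : Set (Fin n))ᶜ) a b))) := by
          linarith [hbad s hs]
        have h1 : ((prodBernoulli u).real (⋃ v ∈ T, openConn v b)
            + (∑ W ∈ (Finset.univ : Finset (Finset (Fin n))).filter (fun W => Disjoint W A),
              (prodBernoulli u).real
                  {ω : BondConfig (Fin n) | ∀ z : Fin n, (z ∈ W ↔ ω ∈ ⋃ v ∈ T, openConn v z)}
                * A.inf' ⟨b, hb⟩ (fun a => (prodBernoulli u).real (openConnIn ((W : Set (Fin n))ᶜ) a b)))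
            - (prodBernoulli u).real (openConn a₀ b)
            - (prodBernoulli u).real
              ((openConn a₀ b)ᶜ ∩ (⋃ v ∈ T, openConn a₀ v) ∩ (⋃ v ∈ T, openConn v b))) * (∑ W ∈ (Finset.univ : Finset (Finset (Fin n))).filter (fun W => s ∈ W ∧ Disjoint W A),
              (prodBernoulli u).real {ω : BondConfig (Fin n) | openCluster ω s = (W : Set (Fin n))}
                * A.inf' ⟨b, hb⟩ (fun a => (prodBernoulli u).real (openConnIn ((W : Set (Fin n))ᶜ) a b))) < 0 :=
          mul_neg_of_neg_of_pos (by linarith) hZpt_pos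
        have h2 : 0 ≤ ((prodBernoulli u).real (openConn s b) + (∑ W ∈ (Finset.univ : Finset (Finset (Fin n))).filter (fun W => s ∈ W ∧ Disjoint W A),
              (prodBernoulli u).real {ω : BondConfig (Fin n) | openCluster ω s = (W : Set (Fin n))}
                * A.inf' ⟨b, hb⟩ (fun a => (prodBernoulli u).real (openConnIn ((W : Set (Fin n))ᶜ) a b))) - (prodBernoulli u).real (openConn a₀ b)) * (∑ W ∈ (Finset.univ : Finset (Finset (Fin n))).filter (fun W => Disjoint W A),
              (prodBernoulli u).real
                  {ω : BondConfig (Fin n) | ∀ z : Fin n, (z ∈ W ↔ ω ∈ ⋃ v ∈ T, openConn v z)}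
                * A.inf' ⟨b, hb⟩ (fun a => (prodBernoulli u).real (openConnIn ((W : Set (Fin n))ᶜ) a b))) :=
          mul_nonneg hKpt (hZnn T)
        linarith
      · -- step: remove a vertex `x ≠ s` and grow it back
        have hT3' : 3 ≤ T.card := by omega
        obtain ⟨x, hx⟩ : ∃ x, x ∈ T.erase s :=
          Finset.card_pos.1 (by rw [Finset.card_erase_of_mem hsT]; omega)
        have hxT : x ∈ T := Finset.mem_of_mem_erase hx
        have hxs : x ≠ s := Finset.ne_of_mem_erase hx
        have hsub : T.erase x ⊆ S := (Finset.erase_subset x T).trans hTS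
        have hsT' : s ∈ T.erase x := Finset.mem_erase.2 ⟨hxs.symm, hsT⟩
        have hcard' : (T.erase x).card = T.card - 1 := Finset.card_erase_of_mem hxT
        have hT2' : 2 ≤ (T.erase x).card := by omega
        have IH := ih (T.card - 1) (by omega) (T.erase x) hsub hsT' hT2' hcard'
        have hTA' : Disjoint (T.erase x) A := Finset.disjoint_of_subset_left hsub hSA
        have hxA : x ∉ A := Finset.disjoint_left.1 hSA (hTS hxT)
        have hxT' : x ∉ T.erase x := Finset.notMem_erase x T
        have ha₀T' : a₀ ∉ T.erase x := fun h => Finset.disjoint_left.1 hTA' h ha₀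
        have hins : insert x (T.erase x) = T := Finset.insert_erase hxT
        by_cases hD : (prodBernoulli u).real (⋃ v ∈ T.erase x, openConn v b)
            < (prodBernoulli u).real (openConn a₀ b)
              + (prodBernoulli u).real
              ((openConn a₀ b)ᶜ ∩ (⋃ v ∈ T.erase x, openConn a₀ v) ∩ (⋃ v ∈ T.erase x, openConn v b))
        · -- PEEL
          have hP := hpeel n u A (T.erase x) b a₀ x hb hTA' hT2' hxA hxT' ha₀ hmin hD
          rw [hins] at hP
          -- `Z_{T'} ≥ D_{T'} > 0`
          have hZpos : 0 < (∑ W ∈ (Finset.univ : Finset (Finset (Fin n))).filter (fun W => Disjoint W A),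
              (prodBernoulli u).real
                  {ω : BondConfig (Fin n) | ∀ z : Fin n, (z ∈ W ↔ ω ∈ ⋃ v ∈ T.erase x, openConn v z)}
                * A.inf' ⟨b, hb⟩ (fun a => (prodBernoulli u).real (openConnIn ((W : Set (Fin n))ᶜ) a b))) := by
            linarith
          by_contra hneg
          push Not at hneg
          -- `D_T · Z_{T'} ≤ D_{T'} · Z_T ≤ Z_{T'} · Z_T`, contradiction with `D_T > Z_T`
          have h3 : ((prodBernoulli u).real (openConn a₀ b)
              + (prodBernoulli u).real
              ((openConn a₀ b)ᶜ ∩ (⋃ v ∈ T.erase x, openConn a₀ v) ∩ (⋃ v ∈ T.erase x, openConn v b))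
              - (prodBernoulli u).real (⋃ v ∈ T.erase x, openConn v b)) * (∑ W ∈ (Finset.univ : Finset (Finset (Fin n))).filter (fun W => Disjoint W A),
              (prodBernoulli u).real
                  {ω : BondConfig (Fin n) | ∀ z : Fin n, (z ∈ W ↔ ω ∈ ⋃ v ∈ T, openConn v z)}
                * A.inf' ⟨b, hb⟩ (fun a => (prodBernoulli u).real (openConnIn ((W : Set (Fin n))ᶜ) a b)))
              ≤ (∑ W ∈ (Finset.univ : Finset (Finset (Fin n))).filter (fun W => Disjoint W A),
              (prodBernoulli u).real
                  {ω : BondConfig (Fin n) | ∀ z : Fin n, (z ∈ W ↔ ω ∈ ⋃ v ∈ T.erase x, openConn v z)}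
                * A.inf' ⟨b, hb⟩ (fun a => (prodBernoulli u).real (openConnIn ((W : Set (Fin n))ᶜ) a b))) * (∑ W ∈ (Finset.univ : Finset (Finset (Fin n))).filter (fun W => Disjoint W A),
              (prodBernoulli u).real
                  {ω : BondConfig (Fin n) | ∀ z : Fin n, (z ∈ W ↔ ω ∈ ⋃ v ∈ T, openConn v z)}
                * A.inf' ⟨b, hb⟩ (fun a => (prodBernoulli u).real (openConnIn ((W : Set (Fin n))ᶜ) a b))) :=
            mul_le_mul_of_nonneg_right (by linarith) (hZnn T)
          have h4 : (∑ W ∈ (Finset.univ : Finset (Finset (Fin n))).filter (fun W => Disjoint W A),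
              (prodBernoulli u).real
                  {ω : BondConfig (Fin n) | ∀ z : Fin n, (z ∈ W ↔ ω ∈ ⋃ v ∈ T.erase x, openConn v z)}
                * A.inf' ⟨b, hb⟩ (fun a => (prodBernoulli u).real (openConnIn ((W : Set (Fin n))ᶜ) a b))) * (∑ W ∈ (Finset.univ : Finset (Finset (Fin n))).filter (fun W => Disjoint W A),
              (prodBernoulli u).real
                  {ω : BondConfig (Fin n) | ∀ z : Fin n, (z ∈ W ↔ ω ∈ ⋃ v ∈ T, openConn v z)}
                * A.inf' ⟨b, hb⟩ (fun a => (prodBernoulli u).real (openConnIn ((W : Set (Fin n))ᶜ) a b)))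
              < ((prodBernoulli u).real (openConn a₀ b)
              + (prodBernoulli u).real
              ((openConn a₀ b)ᶜ ∩ (⋃ v ∈ T, openConn a₀ v) ∩ (⋃ v ∈ T, openConn v b))
              - (prodBernoulli u).real (⋃ v ∈ T, openConn v b)) * (∑ W ∈ (Finset.univ : Finset (Finset (Fin n))).filter (fun W => Disjoint W A),
              (prodBernoulli u).real
                  {ω : BondConfig (Fin n) | ∀ z : Fin n, (z ∈ W ↔ ω ∈ ⋃ v ∈ T.erase x, openConn v z)}
                * A.inf' ⟨b, hb⟩ (fun a => (prodBernoulli u).real (openConnIn ((W : Set (Fin n))ᶜ) a b))) := by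
            rw [mul_comm]
            exact mul_lt_mul_of_pos_right (by linarith) hZpos
          linarith
        · -- good stays good
          push Not at hD
          have hG := hgsg n u (T.erase x) b a₀ x ha₀T' hD
          rw [hins] at hG
          linarith [hZnn T]
  have hS := hchain S.card S (subset_refl S) hs h2 rfl
  -- compare the worst selection with `sel`
  have hsel_le : (∑ W ∈ (Finset.univ : Finset (Finset (Fin n))).filter (fun W => Disjoint W A),
              (prodBernoulli u).real
                  {ω : BondConfig (Fin n) | ∀ z : Fin n, (z ∈ W ↔ ω ∈ ⋃ v ∈ S, openConn v z)}
                * A.inf' ⟨b, hb⟩ (fun a => (prodBernoulli u).real (openConnIn ((W : Set (Fin n))ᶜ) a b))) ≤ ∑ W ∈ (Finset.univ : Finset (Finset (Fin n))).filter (fun W => Disjoint W A),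
      (prodBernoulli u).real {ω : BondConfig (Fin n) | ∀ z : Fin n, (z ∈ W ↔ ω ∈ ⋃ v ∈ S, openConn v z)}
        * (prodBernoulli u).real (openConnIn ((W : Set (Fin n))ᶜ) (sel W) b) := by
    refine Finset.sum_le_sum fun W _ => mul_le_mul_of_nonneg_left ?_ measureReal_nonneg
    exact Finset.inf'_le _ (hsel W)
  linarith

/-- **The inductive step `stub_goodStep` (verbatim) from the three stubs.**  Real proof (as in line `pocket-deficit-ratio`):
`goodStep24_main`; un-gluing (H3); the residue by `blockGood_of_peel` with the induction hypothesis for a point of the block. -/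
theorem goodStep_of_peel
    (hpair : ∀ (n : ℕ) (u : Sym2 (Fin n) → unitInterval) (A S : Finset (Fin n)) (b a₀ s : Fin n) (hb : b ∈ A),
      Disjoint S A → s ∈ S → a₀ ∈ A →
      (∀ a ∈ A, (prodBernoulli u).real (openConn a₀ b) ≤ (prodBernoulli u).real (openConn a b)) →
      (∀ v ∈ S, (prodBernoulli u).real (openConn v b) < (prodBernoulli u).real (openConn a₀ b)) →
      S.card = 2 →
      0 ≤ (prodBernoulli u).real (openConn s b)
          + (∑ W ∈ (Finset.univ : Finset (Finset (Fin n))).filter (fun W => s ∈ W ∧ Disjoint W A),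
              (prodBernoulli u).real {ω : BondConfig (Fin n) | openCluster ω s = (W : Set (Fin n))}
                * A.inf' ⟨b, hb⟩ (fun a => (prodBernoulli u).real (openConnIn ((W : Set (Fin n))ᶜ) a b)))
          - (prodBernoulli u).real (openConn a₀ b) →
      ((prodBernoulli u).real (openConn s b)
          + (∑ W ∈ (Finset.univ : Finset (Finset (Fin n))).filter (fun W => s ∈ W ∧ Disjoint W A),
              (prodBernoulli u).real {ω : BondConfig (Fin n) | openCluster ω s = (W : Set (Fin n))}
                * A.inf' ⟨b, hb⟩ (fun a => (prodBernoulli u).real (openConnIn ((W : Set (Fin n))ᶜ) a b)))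
          - (prodBernoulli u).real (openConn a₀ b))
        * (∑ W ∈ (Finset.univ : Finset (Finset (Fin n))).filter (fun W => Disjoint W A),
              (prodBernoulli u).real
                  {ω : BondConfig (Fin n) | ∀ z : Fin n, (z ∈ W ↔ ω ∈ ⋃ v ∈ S, openConn v z)}
                * A.inf' ⟨b, hb⟩ (fun a => (prodBernoulli u).real (openConnIn ((W : Set (Fin n))ᶜ) a b)))
      ≤ ((prodBernoulli u).real (⋃ v ∈ S, openConn v b)
          + (∑ W ∈ (Finset.univ : Finset (Finset (Fin n))).filter (fun W => Disjoint W A),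
              (prodBernoulli u).real
                  {ω : BondConfig (Fin n) | ∀ z : Fin n, (z ∈ W ↔ ω ∈ ⋃ v ∈ S, openConn v z)}
                * A.inf' ⟨b, hb⟩ (fun a => (prodBernoulli u).real (openConnIn ((W : Set (Fin n))ᶜ) a b)))
          - (prodBernoulli u).real (openConn a₀ b)
          - (prodBernoulli u).real
              ((openConn a₀ b)ᶜ ∩ (⋃ v ∈ S, openConn a₀ v) ∩ (⋃ v ∈ S, openConn v b)))
        * (∑ W ∈ (Finset.univ : Finset (Finset (Fin n))).filter (fun W => s ∈ W ∧ Disjoint W A),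
              (prodBernoulli u).real {ω : BondConfig (Fin n) | openCluster ω s = (W : Set (Fin n))}
                * A.inf' ⟨b, hb⟩ (fun a => (prodBernoulli u).real (openConnIn ((W : Set (Fin n))ᶜ) a b))))
    (hpeel : ∀ (n : ℕ) (u : Sym2 (Fin n) → unitInterval) (A T : Finset (Fin n)) (b a₀ x : Fin n) (hb : b ∈ A),
      Disjoint T A → 2 ≤ T.card → x ∉ A → x ∉ T → a₀ ∈ A →
      (∀ a ∈ A, (prodBernoulli u).real (openConn a₀ b) ≤ (prodBernoulli u).real (openConn a b)) →
      (prodBernoulli u).real (⋃ v ∈ T, openConn v b)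
        < (prodBernoulli u).real (openConn a₀ b)
          + (prodBernoulli u).real
              ((openConn a₀ b)ᶜ ∩ (⋃ v ∈ T, openConn a₀ v) ∩ (⋃ v ∈ T, openConn v b)) →
      ((prodBernoulli u).real (openConn a₀ b)
          + (prodBernoulli u).real
              ((openConn a₀ b)ᶜ ∩ (⋃ v ∈ insert x T, openConn a₀ v) ∩ (⋃ v ∈ insert x T, openConn v b))
          - (prodBernoulli u).real (⋃ v ∈ insert x T, openConn v b))
        * (∑ W ∈ (Finset.univ : Finset (Finset (Fin n))).filter (fun W => Disjoint W A),
              (prodBernoulli u).real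
                  {ω : BondConfig (Fin n) | ∀ z : Fin n, (z ∈ W ↔ ω ∈ ⋃ v ∈ T, openConn v z)}
                * A.inf' ⟨b, hb⟩ (fun a => (prodBernoulli u).real (openConnIn ((W : Set (Fin n))ᶜ) a b)))
      ≤ ((prodBernoulli u).real (openConn a₀ b)
          + (prodBernoulli u).real
              ((openConn a₀ b)ᶜ ∩ (⋃ v ∈ T, openConn a₀ v) ∩ (⋃ v ∈ T, openConn v b))
          - (prodBernoulli u).real (⋃ v ∈ T, openConn v b))
        * (∑ W ∈ (Finset.univ : Finset (Finset (Fin n))).filter (fun W => Disjoint W A),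
              (prodBernoulli u).real
                  {ω : BondConfig (Fin n) | ∀ z : Fin n, (z ∈ W ↔ ω ∈ ⋃ v ∈ insert x T, openConn v z)}
                * A.inf' ⟨b, hb⟩ (fun a => (prodBernoulli u).real (openConnIn ((W : Set (Fin n))ᶜ) a b))))
    (hgsg : ∀ (n : ℕ) (u : Sym2 (Fin n) → unitInterval) (T : Finset (Fin n)) (b a₀ x : Fin n),
      a₀ ∉ T →
      (prodBernoulli u).real (openConn a₀ b)
          + (prodBernoulli u).real
              ((openConn a₀ b)ᶜ ∩ (⋃ v ∈ T, openConn a₀ v) ∩ (⋃ v ∈ T, openConn v b))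
        ≤ (prodBernoulli u).real (⋃ v ∈ T, openConn v b) →
      (prodBernoulli u).real (openConn a₀ b)
          + (prodBernoulli u).real
              ((openConn a₀ b)ᶜ ∩ (⋃ v ∈ insert x T, openConn a₀ v) ∩ (⋃ v ∈ insert x T, openConn v b))
        ≤ (prodBernoulli u).real (⋃ v ∈ insert x T, openConn v b)) :
    ∀ (n : ℕ) (w : Sym2 (Fin n) → unitInterval) (A : Finset (Fin n)) (o b : Fin n),
      b ∈ A → o ∉ A →
      (∃ y : Fin n, y ∉ A ∧ y ≠ o ∧ (w s(o, y) : ℝ) ≠ 0) →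
      (∀ w' : Sym2 (Fin n) → unitInterval,
        (Finset.univ.filter (fun v : Fin n => ∃ u : Fin n, 0 < (w' s(u, v) : ℝ))).card
          < (Finset.univ.filter (fun v : Fin n => ∃ u : Fin n, 0 < (w s(u, v) : ℝ))).card →
        ∀ (A' : Finset (Fin n)) (o' b' : Fin n), b' ∈ A' → o' ∉ A' →
        ∀ (t : ℝ) (sel : Finset (Fin n) → Fin n), (∀ W, sel W ∈ A') →
          (∀ a ∈ A', 1 - t ≤ (prodBernoulli w').real (openConn a b')) →
          (prodBernoulli w').real ((⋃ a ∈ A', openConn o' a) ∩ (openConn o' b')ᶜ)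
            + ∑ W ∈ (Finset.univ : Finset (Finset (Fin n))).filter (fun W => o' ∈ W ∧ Disjoint W A'),
                (prodBernoulli w').real {ω : BondConfig (Fin n) | openCluster ω o' = (W : Set (Fin n))}
                  * (prodBernoulli w').real (openConnIn ((W : Set (Fin n))ᶜ) (sel W) b')ᶜ
            ≤ t) →
      ∀ (t : ℝ) (sel : Finset (Fin n) → Fin n), (∀ W, sel W ∈ A) →
        (∀ a ∈ A, 1 - t ≤ (prodBernoulli w).real (openConn a b)) →
        (prodBernoulli w).real ((⋃ a ∈ A, openConn o a) ∩ (openConn o b)ᶜ)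
          + ∑ W ∈ (Finset.univ : Finset (Finset (Fin n))).filter (fun W => o ∈ W ∧ Disjoint W A),
              (prodBernoulli w).real {ω : BondConfig (Fin n) | openCluster ω o = (W : Set (Fin n))}
                * (prodBernoulli w).real (openConnIn ((W : Set (Fin n))ᶜ) (sel W) b)ᶜ
          ≤ t := by
  intro n w A o b hb ho hlow IH
  obtain ⟨y₀, -, -, hy₀⟩ := id hlow
  refine goodStep24_main n w A o b hb ho hlow IH ?_
  intro S sel a₀ h2 hoS hSA hSw hsel ha₀ hmin hbad
  set K : Sym2 (Fin n) → unitInterval := fun e => if o ∈ e then (0 : unitInterval) else w e with hK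
  obtain ⟨s₀, hs₀⟩ := Finset.card_pos.1 (lt_of_lt_of_le zero_lt_two h2)
  have hs₀A : s₀ ∉ A := Finset.disjoint_left.1 hSA hs₀
  rw [blockGrowth_glue_real_openConn, blockGrowth_glue_real_iUnion K S b]
  simp only [blockGrowth_glue_real_pocket K S]
  have hgood := IH K (goodStep_card_lt w hy₀) A s₀ b hb hs₀A
  exact blockGood_of_peel K A S b a₀ s₀ (fun W' => sel (insert o W')) hb (fun W' => hsel _) hSA hs₀ h2 ha₀ hmin hbad
    hpair hpeel hgsg hgood

/-- **Every quadruple is good** from the three stubs: strong induction on the number of positive-degree vertices; base = the landed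
`stub_goodBase` (with `stub_lemma5AnyRelay`), step = `goodStep_of_peel`. -/
theorem good_all_of_peel
    (hpair : ∀ (n : ℕ) (u : Sym2 (Fin n) → unitInterval) (A S : Finset (Fin n)) (b a₀ s : Fin n) (hb : b ∈ A),
      Disjoint S A → s ∈ S → a₀ ∈ A →
      (∀ a ∈ A, (prodBernoulli u).real (openConn a₀ b) ≤ (prodBernoulli u).real (openConn a b)) →
      (∀ v ∈ S, (prodBernoulli u).real (openConn v b) < (prodBernoulli u).real (openConn a₀ b)) →
      S.card = 2 →
      0 ≤ (prodBernoulli u).real (openConn s b)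
          + (∑ W ∈ (Finset.univ : Finset (Finset (Fin n))).filter (fun W => s ∈ W ∧ Disjoint W A),
              (prodBernoulli u).real {ω : BondConfig (Fin n) | openCluster ω s = (W : Set (Fin n))}
                * A.inf' ⟨b, hb⟩ (fun a => (prodBernoulli u).real (openConnIn ((W : Set (Fin n))ᶜ) a b)))
          - (prodBernoulli u).real (openConn a₀ b) →
      ((prodBernoulli u).real (openConn s b)
          + (∑ W ∈ (Finset.univ : Finset (Finset (Fin n))).filter (fun W => s ∈ W ∧ Disjoint W A),
              (prodBernoulli u).real {ω : BondConfig (Fin n) | openCluster ω s = (W : Set (Fin n))}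
                * A.inf' ⟨b, hb⟩ (fun a => (prodBernoulli u).real (openConnIn ((W : Set (Fin n))ᶜ) a b)))
          - (prodBernoulli u).real (openConn a₀ b))
        * (∑ W ∈ (Finset.univ : Finset (Finset (Fin n))).filter (fun W => Disjoint W A),
              (prodBernoulli u).real
                  {ω : BondConfig (Fin n) | ∀ z : Fin n, (z ∈ W ↔ ω ∈ ⋃ v ∈ S, openConn v z)}
                * A.inf' ⟨b, hb⟩ (fun a => (prodBernoulli u).real (openConnIn ((W : Set (Fin n))ᶜ) a b)))
      ≤ ((prodBernoulli u).real (⋃ v ∈ S, openConn v b)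
          + (∑ W ∈ (Finset.univ : Finset (Finset (Fin n))).filter (fun W => Disjoint W A),
              (prodBernoulli u).real
                  {ω : BondConfig (Fin n) | ∀ z : Fin n, (z ∈ W ↔ ω ∈ ⋃ v ∈ S, openConn v z)}
                * A.inf' ⟨b, hb⟩ (fun a => (prodBernoulli u).real (openConnIn ((W : Set (Fin n))ᶜ) a b)))
          - (prodBernoulli u).real (openConn a₀ b)
          - (prodBernoulli u).real
              ((openConn a₀ b)ᶜ ∩ (⋃ v ∈ S, openConn a₀ v) ∩ (⋃ v ∈ S, openConn v b)))
        * (∑ W ∈ (Finset.univ : Finset (Finset (Fin n))).filter (fun W => s ∈ W ∧ Disjoint W A),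
              (prodBernoulli u).real {ω : BondConfig (Fin n) | openCluster ω s = (W : Set (Fin n))}
                * A.inf' ⟨b, hb⟩ (fun a => (prodBernoulli u).real (openConnIn ((W : Set (Fin n))ᶜ) a b))))
    (hpeel : ∀ (n : ℕ) (u : Sym2 (Fin n) → unitInterval) (A T : Finset (Fin n)) (b a₀ x : Fin n) (hb : b ∈ A),
      Disjoint T A → 2 ≤ T.card → x ∉ A → x ∉ T → a₀ ∈ A →
      (∀ a ∈ A, (prodBernoulli u).real (openConn a₀ b) ≤ (prodBernoulli u).real (openConn a b)) →
      (prodBernoulli u).real (⋃ v ∈ T, openConn v b)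
        < (prodBernoulli u).real (openConn a₀ b)
          + (prodBernoulli u).real
              ((openConn a₀ b)ᶜ ∩ (⋃ v ∈ T, openConn a₀ v) ∩ (⋃ v ∈ T, openConn v b)) →
      ((prodBernoulli u).real (openConn a₀ b)
          + (prodBernoulli u).real
              ((openConn a₀ b)ᶜ ∩ (⋃ v ∈ insert x T, openConn a₀ v) ∩ (⋃ v ∈ insert x T, openConn v b))
          - (prodBernoulli u).real (⋃ v ∈ insert x T, openConn v b))
        * (∑ W ∈ (Finset.univ : Finset (Finset (Fin n))).filter (fun W => Disjoint W A),
              (prodBernoulli u).real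
                  {ω : BondConfig (Fin n) | ∀ z : Fin n, (z ∈ W ↔ ω ∈ ⋃ v ∈ T, openConn v z)}
                * A.inf' ⟨b, hb⟩ (fun a => (prodBernoulli u).real (openConnIn ((W : Set (Fin n))ᶜ) a b)))
      ≤ ((prodBernoulli u).real (openConn a₀ b)
          + (prodBernoulli u).real
              ((openConn a₀ b)ᶜ ∩ (⋃ v ∈ T, openConn a₀ v) ∩ (⋃ v ∈ T, openConn v b))
          - (prodBernoulli u).real (⋃ v ∈ T, openConn v b))
        * (∑ W ∈ (Finset.univ : Finset (Finset (Fin n))).filter (fun W => Disjoint W A),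
              (prodBernoulli u).real
                  {ω : BondConfig (Fin n) | ∀ z : Fin n, (z ∈ W ↔ ω ∈ ⋃ v ∈ insert x T, openConn v z)}
                * A.inf' ⟨b, hb⟩ (fun a => (prodBernoulli u).real (openConnIn ((W : Set (Fin n))ᶜ) a b))))
    (hgsg : ∀ (n : ℕ) (u : Sym2 (Fin n) → unitInterval) (T : Finset (Fin n)) (b a₀ x : Fin n),
      a₀ ∉ T →
      (prodBernoulli u).real (openConn a₀ b)
          + (prodBernoulli u).real
              ((openConn a₀ b)ᶜ ∩ (⋃ v ∈ T, openConn a₀ v) ∩ (⋃ v ∈ T, openConn v b))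
        ≤ (prodBernoulli u).real (⋃ v ∈ T, openConn v b) →
      (prodBernoulli u).real (openConn a₀ b)
          + (prodBernoulli u).real
              ((openConn a₀ b)ᶜ ∩ (⋃ v ∈ insert x T, openConn a₀ v) ∩ (⋃ v ∈ insert x T, openConn v b))
        ≤ (prodBernoulli u).real (⋃ v ∈ insert x T, openConn v b)) (n : ℕ) :
    ∀ (w : Sym2 (Fin n) → unitInterval) (A : Finset (Fin n)) (o b : Fin n),
      b ∈ A → o ∉ A →
      ∀ (t : ℝ) (sel : Finset (Fin n) → Fin n), (∀ W, sel W ∈ A) →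
        (∀ a ∈ A, 1 - t ≤ (prodBernoulli w).real (openConn a b)) →
        (prodBernoulli w).real ((⋃ a ∈ A, openConn o a) ∩ (openConn o b)ᶜ)
          + ∑ W ∈ (Finset.univ : Finset (Finset (Fin n))).filter (fun W => o ∈ W ∧ Disjoint W A),
              (prodBernoulli w).real {ω : BondConfig (Fin n) | openCluster ω o = (W : Set (Fin n))}
                * (prodBernoulli w).real (openConnIn ((W : Set (Fin n))ᶜ) (sel W) b)ᶜ
          ≤ t := by
  suffices h : ∀ (k : ℕ) (w : Sym2 (Fin n) → unitInterval),
      (Finset.univ.filter (fun v : Fin n => ∃ u : Fin n, 0 < (w s(u, v) : ℝ))).card = k →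
      ∀ (A : Finset (Fin n)) (o b : Fin n),
      b ∈ A → o ∉ A →
      ∀ (t : ℝ) (sel : Finset (Fin n) → Fin n), (∀ W, sel W ∈ A) →
        (∀ a ∈ A, 1 - t ≤ (prodBernoulli w).real (openConn a b)) →
        (prodBernoulli w).real ((⋃ a ∈ A, openConn o a) ∩ (openConn o b)ᶜ)
          + ∑ W ∈ (Finset.univ : Finset (Finset (Fin n))).filter (fun W => o ∈ W ∧ Disjoint W A),
              (prodBernoulli w).real {ω : BondConfig (Fin n) | openCluster ω o = (W : Set (Fin n))}
                * (prodBernoulli w).real (openConnIn ((W : Set (Fin n))ᶜ) (sel W) b)ᶜ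
          ≤ t by
    intro w A o b hb ho
    exact h _ w rfl A o b hb ho
  intro k
  induction k using Nat.strong_induction_on with
  | _ k ih =>
    intro w hk A o b hb ho
    by_cases hiso : ∀ y : Fin n, y ∉ A → y ≠ o → (w s(o, y) : ℝ) = 0
    · exact stub_goodBase stub_lemma5AnyRelay n w A o b hb ho hiso
    · push Not at hiso
      refine goodStep_of_peel hpair hpeel hgsg n w A o b hb ho hiso ?_
      intro w' hw' A' o' b' hb' ho'
      exact ih _ (hk ▸ hw') w' rfl A' o' b' hb' ho'

/-- **`AdditiveGluing` (its statement, verbatim) from the three stubs.**  Real proof: KN's level-set normal form (as in the registered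
skeletons).  Unfolded conclusion so that `additiveGluing_closed` below is the only theorem whose conclusion is the crux constant. -/
theorem AdditiveGluing_of
    (hpair : ∀ (n : ℕ) (u : Sym2 (Fin n) → unitInterval) (A S : Finset (Fin n)) (b a₀ s : Fin n) (hb : b ∈ A),
      Disjoint S A → s ∈ S → a₀ ∈ A →
      (∀ a ∈ A, (prodBernoulli u).real (openConn a₀ b) ≤ (prodBernoulli u).real (openConn a b)) →
      (∀ v ∈ S, (prodBernoulli u).real (openConn v b) < (prodBernoulli u).real (openConn a₀ b)) →
      S.card = 2 →
      0 ≤ (prodBernoulli u).real (openConn s b)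
          + (∑ W ∈ (Finset.univ : Finset (Finset (Fin n))).filter (fun W => s ∈ W ∧ Disjoint W A),
              (prodBernoulli u).real {ω : BondConfig (Fin n) | openCluster ω s = (W : Set (Fin n))}
                * A.inf' ⟨b, hb⟩ (fun a => (prodBernoulli u).real (openConnIn ((W : Set (Fin n))ᶜ) a b)))
          - (prodBernoulli u).real (openConn a₀ b) →
      ((prodBernoulli u).real (openConn s b)
          + (∑ W ∈ (Finset.univ : Finset (Finset (Fin n))).filter (fun W => s ∈ W ∧ Disjoint W A),
              (prodBernoulli u).real {ω : BondConfig (Fin n) | openCluster ω s = (W : Set (Fin n))}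
                * A.inf' ⟨b, hb⟩ (fun a => (prodBernoulli u).real (openConnIn ((W : Set (Fin n))ᶜ) a b)))
          - (prodBernoulli u).real (openConn a₀ b))
        * (∑ W ∈ (Finset.univ : Finset (Finset (Fin n))).filter (fun W => Disjoint W A),
              (prodBernoulli u).real
                  {ω : BondConfig (Fin n) | ∀ z : Fin n, (z ∈ W ↔ ω ∈ ⋃ v ∈ S, openConn v z)}
                * A.inf' ⟨b, hb⟩ (fun a => (prodBernoulli u).real (openConnIn ((W : Set (Fin n))ᶜ) a b)))
      ≤ ((prodBernoulli u).real (⋃ v ∈ S, openConn v b)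
          + (∑ W ∈ (Finset.univ : Finset (Finset (Fin n))).filter (fun W => Disjoint W A),
              (prodBernoulli u).real
                  {ω : BondConfig (Fin n) | ∀ z : Fin n, (z ∈ W ↔ ω ∈ ⋃ v ∈ S, openConn v z)}
                * A.inf' ⟨b, hb⟩ (fun a => (prodBernoulli u).real (openConnIn ((W : Set (Fin n))ᶜ) a b)))
          - (prodBernoulli u).real (openConn a₀ b)
          - (prodBernoulli u).real
              ((openConn a₀ b)ᶜ ∩ (⋃ v ∈ S, openConn a₀ v) ∩ (⋃ v ∈ S, openConn v b)))
        * (∑ W ∈ (Finset.univ : Finset (Finset (Fin n))).filter (fun W => s ∈ W ∧ Disjoint W A),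
              (prodBernoulli u).real {ω : BondConfig (Fin n) | openCluster ω s = (W : Set (Fin n))}
                * A.inf' ⟨b, hb⟩ (fun a => (prodBernoulli u).real (openConnIn ((W : Set (Fin n))ᶜ) a b))))
    (hpeel : ∀ (n : ℕ) (u : Sym2 (Fin n) → unitInterval) (A T : Finset (Fin n)) (b a₀ x : Fin n) (hb : b ∈ A),
      Disjoint T A → 2 ≤ T.card → x ∉ A → x ∉ T → a₀ ∈ A →
      (∀ a ∈ A, (prodBernoulli u).real (openConn a₀ b) ≤ (prodBernoulli u).real (openConn a b)) →
      (prodBernoulli u).real (⋃ v ∈ T, openConn v b)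
        < (prodBernoulli u).real (openConn a₀ b)
          + (prodBernoulli u).real
              ((openConn a₀ b)ᶜ ∩ (⋃ v ∈ T, openConn a₀ v) ∩ (⋃ v ∈ T, openConn v b)) →
      ((prodBernoulli u).real (openConn a₀ b)
          + (prodBernoulli u).real
              ((openConn a₀ b)ᶜ ∩ (⋃ v ∈ insert x T, openConn a₀ v) ∩ (⋃ v ∈ insert x T, openConn v b))
          - (prodBernoulli u).real (⋃ v ∈ insert x T, openConn v b))
        * (∑ W ∈ (Finset.univ : Finset (Finset (Fin n))).filter (fun W => Disjoint W A),
              (prodBernoulli u).real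
                  {ω : BondConfig (Fin n) | ∀ z : Fin n, (z ∈ W ↔ ω ∈ ⋃ v ∈ T, openConn v z)}
                * A.inf' ⟨b, hb⟩ (fun a => (prodBernoulli u).real (openConnIn ((W : Set (Fin n))ᶜ) a b)))
      ≤ ((prodBernoulli u).real (openConn a₀ b)
          + (prodBernoulli u).real
              ((openConn a₀ b)ᶜ ∩ (⋃ v ∈ T, openConn a₀ v) ∩ (⋃ v ∈ T, openConn v b))
          - (prodBernoulli u).real (⋃ v ∈ T, openConn v b))
        * (∑ W ∈ (Finset.univ : Finset (Finset (Fin n))).filter (fun W => Disjoint W A),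
              (prodBernoulli u).real
                  {ω : BondConfig (Fin n) | ∀ z : Fin n, (z ∈ W ↔ ω ∈ ⋃ v ∈ insert x T, openConn v z)}
                * A.inf' ⟨b, hb⟩ (fun a => (prodBernoulli u).real (openConnIn ((W : Set (Fin n))ᶜ) a b))))
    (hgsg : ∀ (n : ℕ) (u : Sym2 (Fin n) → unitInterval) (T : Finset (Fin n)) (b a₀ x : Fin n),
      a₀ ∉ T →
      (prodBernoulli u).real (openConn a₀ b)
          + (prodBernoulli u).real
              ((openConn a₀ b)ᶜ ∩ (⋃ v ∈ T, openConn a₀ v) ∩ (⋃ v ∈ T, openConn v b))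
        ≤ (prodBernoulli u).real (⋃ v ∈ T, openConn v b) →
      (prodBernoulli u).real (openConn a₀ b)
          + (prodBernoulli u).real
              ((openConn a₀ b)ᶜ ∩ (⋃ v ∈ insert x T, openConn a₀ v) ∩ (⋃ v ∈ insert x T, openConn v b))
        ≤ (prodBernoulli u).real (⋃ v ∈ insert x T, openConn v b)) :
    ∀ (n : ℕ) (w : Sym2 (Fin n) → unitInterval) (A : Finset (Fin n)) (o b : Fin n) (t : ℝ), 0 ≤ t →
      (∀ a ∈ A, 1 - t ≤ (prodBernoulli w).real (openConn a b)) →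
      (prodBernoulli w).real (⋃ a ∈ A, openConn o a) - t ≤ (prodBernoulli w).real (openConn o b) := by
  intro n w A o b t ht hA
  have hU1 : (prodBernoulli w).real (⋃ a ∈ A, (openConn o a : Set (BondConfig (Fin n)))) ≤ 1 :=
    measureReal_le_one
  have hob0 : 0 ≤ (prodBernoulli w).real (openConn o b : Set (BondConfig (Fin n))) := measureReal_nonneg
  by_cases ht1 : 1 ≤ t
  · linarith
  push Not at ht1
  have hbb : (prodBernoulli w).real (openConn b b : Set (BondConfig (Fin n))) = 1 := by
    have h : (openConn b b : Set (BondConfig (Fin n))) = Set.univ :=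
      Set.eq_univ_of_forall fun ω => (SimpleGraph.Reachable.refl b : (openGraph ω).Reachable b b)
    rw [h, probReal_univ]
  have hbA' : b ∈ Finset.univ.filter (fun x : Fin n => 1 - t ≤ (prodBernoulli w).real (openConn x b)) := by
    rw [Finset.mem_filter]
    refine ⟨Finset.mem_univ _, ?_⟩
    rw [hbb]
    linarith
  have hAA' : ∀ a ∈ A, a ∈ Finset.univ.filter (fun x : Fin n => 1 - t ≤ (prodBernoulli w).real (openConn x b)) :=
    fun a ha => by
      rw [Finset.mem_filter]
      exact ⟨Finset.mem_univ _, hA a ha⟩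
  have hmemA' : ∀ x ∈ Finset.univ.filter (fun x : Fin n => 1 - t ≤ (prodBernoulli w).real (openConn x b)),
      1 - t ≤ (prodBernoulli w).real (openConn x b) := fun x hx => by
    rw [Finset.mem_filter] at hx
    exact hx.2
  by_cases ho : o ∈ Finset.univ.filter (fun x : Fin n => 1 - t ≤ (prodBernoulli w).real (openConn x b))
  · have := hmemA' o ho
    linarith
  have hgood := good_all_of_peel hpair hpeel hgsg n w
    (Finset.univ.filter (fun x : Fin n => 1 - t ≤ (prodBernoulli w).real (openConn x b))) o b hbA' ho t
    (fun _ => b) (fun _ => hbA') hmemA'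
  have hsum : 0 ≤ ∑ W ∈ (Finset.univ : Finset (Finset (Fin n))).filter (fun W => o ∈ W ∧
      Disjoint W (Finset.univ.filter (fun x : Fin n => 1 - t ≤ (prodBernoulli w).real (openConn x b)))),
        (prodBernoulli w).real {ω : BondConfig (Fin n) | openCluster ω o = (W : Set (Fin n))}
          * (prodBernoulli w).real (openConnIn ((W : Set (Fin n))ᶜ) ((fun _ => b) W) b)ᶜ :=
    Finset.sum_nonneg fun W _ => mul_nonneg measureReal_nonneg measureReal_nonneg
  have hlive : (prodBernoulli w).real
      ((⋃ a ∈ Finset.univ.filter (fun x : Fin n => 1 - t ≤ (prodBernoulli w).real (openConn x b)),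
        (openConn o a : Set (BondConfig (Fin n)))) ∩ (openConn o b)ᶜ) ≤ t := by
    linarith
  have hsub : (⋃ a ∈ A, (openConn o a : Set (BondConfig (Fin n)))) ⊆
      ((⋃ a ∈ Finset.univ.filter (fun x : Fin n => 1 - t ≤ (prodBernoulli w).real (openConn x b)),
        (openConn o a : Set (BondConfig (Fin n)))) ∩ (openConn o b)ᶜ) ∪ openConn o b := by
    intro ω hω
    by_cases hb : ω ∈ openConn o b
    · exact Or.inr hb
    · refine Or.inl ⟨?_, hb⟩
      simp only [Set.mem_iUnion] at hω ⊢
      obtain ⟨a, ha, hωa⟩ := hω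
      exact ⟨a, hAA' a ha, hωa⟩
  have hfin := (measureReal_mono (μ := prodBernoulli w) hsub).trans (measureReal_union_le _ _)
  linarith



/-- **The crux BY NAME from the five registered stubs** (the skeleton theorem). -/
theorem additiveGluing_closed :
    Summit.CriticalPhenomena.PercolationContinuityZ3.Theses.PercNearOneGluing.AdditiveGluing :=
  AdditiveGluing_of (ratioMonotonePair_of_split stub_hijackSplitBHK stub_pairResidual stub_gainIdentity)
    stub_peel stub_goodStaysGoodBlock

end

end Summit.CriticalPhenomena.PercolationContinuityZ3.Cruxes.AdditiveGluing.BhkSplit
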